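import Literature.Barriers.ValiantsHypothesis.CT23ProjCircuitInputNormalisation
import HarnessLib

/-!
# From the hypotheses of CT23 Thm. 3.1 to pre-specialised input-free encoders
# (Chatterjee–Tengse arXiv:2309.07612v2, Def. 1.7 + Lemma 3.5's copies `C_G(·, a_t)`;
# val-lit t20 g9, X-CT23 front-end glue for the assembly of `CT23_thm_3_1`, RULING (107)(b))

Theorem-only (plus plumbing `def`s) companion of `CT23ProjCircuitInputNormalisation.lean` (brick
E-n) and `CT23ProjCircuitSubstitution.lean` (brick E-a); NO named facts. Honest framing: circuit
bookkeeping for the source's `VPSPACE` constructions; it discharges nothing by itself;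
`VP ≠ VNP` is NOT proved and nothing here bears on it.

## What

The typed fact `CT23_thm_3_1` hands the assembly an ARBITRARY fan-in-two circuit with
projections `Q : ProjCircuit F ((Fin m ⊕ Fin r) ⊕ Fin w)` of size `≤ s` computing `U(z, y)`
(`rename Sum.inl U`) together with Def. 1.7 assignments `a_t : Fin r → F`, `U(z, a_t) = G_t(z)`
(`Encodes U G`); neither `r` nor `w` is bounded. Lemma 3.5's encoder (v1 Lemma 42,
p0015.txt:L80–L102: "`ROW(i) := LT(i,k)·C_G(pow(i)) + EQ(i,k)·x`") consumes `n'` COPIES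
`C_G(·, a_t)` into which it substitutes; in the tree (bricks E-e′ / E-f) these are
pre-specialised circuits `Q_t : ProjCircuit F (Fin m ⊕ Fin t₀)` over ONE common small workspace,
each computing `rename Sum.inl (G t)` and projecting WORKSPACE variables only. This file produces
them (`ProjCircuit.exists_specialised_inputFree`, `t₀ ≤ 9s + 4`, sizes `≤ 17s + 5`):

1. **workspace compression** (`ProjCircuit.compress`): only the `≤ 3s + 1` workspace variables
   `Q` touches are kept (slots `1 … `, untouched ones are sent to the junk slot `0` with the
   constant operand `0` — they never occur, so brick E-a's `SubstCompat` holds globally);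
2. **input normalisation** (brick E-n's `ProjCircuit.inputFree`: afterwards no projection binds
   an input, size `≤ 17s + 5`, workspace `+ 2·(3s + 1)`);
3. **specialisation** `y := a_t` (`ProjCircuit.specialise`: constant operands for the `y`-leaves,
   brick E-a's `subst` with empty prefix — sound BECAUSE step 2 made the circuit input-free,
   which is exactly where the printed proof's gap (registry B43) sat).

Plus the size arithmetic of the assembly, `mul_frontEnd_pow_le : (m·d·(17s+5))^c ≤ (m·d·s)^(6c)`
(`s ≥ 2`, `m, d ≥ 1`).

## References

* [ChatterjeeTengse2023] P. Chatterjee, A. Tengse, *Lower Bounds from Succinct Hitting Sets*,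
  arXiv:2309.07612v2: Def. 1.7 (v1 Def. 5, p0005.txt:L38), Def. 2.19–2.20 (v1 Def. 27–28),
  Thm. 3.1 (v1 §3, p0014.txt:L6–L10), Lemma 3.5 (v1 Lemma 42, p0015.txt:L80–L102), §3.3
  (v1 p0016.txt:L12–L24, the size count `(m·d·s)^c`).
* Cell records: val-lit registry B43; lead-np RULINGS (102)(a), (107)(b).
-/

noncomputable section

open MvPolynomial

namespace Literature.Barriers.ValiantsHypothesis

open Literature.Computability.AlgebraicComplexity

universe u v

variable {k : Type u} [CommRing k] {σ : Type v} [DecidableEq σ]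

/-! ## Front end of the assembly: workspace compression, specialisation of the index variables,
and the passage from the hypotheses of `CT23_thm_3_1` to pre-specialised input-free encoders -/

namespace ProjCircuit

section SubstNil

universe uτ

variable {τ : Type uτ} [DecidableEq τ]

omit [CommRing k] [DecidableEq σ] [DecidableEq τ] in
/-- A substitution with empty prefix maps the projected variables along the relabelling.
[cite: ChatterjeeTengse2023, Def. 2.19–2.20 (v1: Def. 27–28)] -/
theorem projVars_subst_nil_subset (Q : ProjCircuit k σ) (e : σ → τ)
    (ρ : σ → ArithCircuit.Operand k τ) : (Q.subst [] e ρ).projVars ⊆ e '' Q.projVars := by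
  rintro v ⟨c, u, hg⟩
  simp only [subst, List.nil_append, List.mem_map] at hg
  obtain ⟨g, hg, hge⟩ := hg
  cases g with
  | arith g => simp [Gate.subst] at hge
  | proj i b u' =>
    simp only [Gate.subst, Gate.proj.injEq] at hge
    obtain ⟨rfl, -, -⟩ := hge
    exact ⟨i, ⟨b, u', hg⟩, rfl⟩

omit [CommRing k] [DecidableEq σ] [DecidableEq τ] in
/-- A substitution with empty prefix keeps the size. [cite: ChatterjeeTengse2023, Def. 2.20 (v1: Def. 28)] -/
theorem size_subst_nil (Q : ProjCircuit k σ) (e : σ → τ) (ρ : σ → ArithCircuit.Operand k τ) :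
    (Q.subst [] e ρ).size = Q.size := by
  simp

end SubstNil

section FrontEnd

variable {ι : Type v} [DecidableEq ι] {w : ℕ}

/-! #### Workspace compression: only the touched workspace variables are kept -/

/-- The workspace variables `Q` touches (reads or projects).
[cite: ChatterjeeTengse2023, Lemma 3.5 (v1: Lemma 42)] -/
def touchedWork (Q : ProjCircuit k (ι ⊕ Fin w)) : Finset (Fin w) :=
  (Q.varSet ∪ Q.projFinset).toRight

omit [CommRing k] in
/-- A fan-in-two circuit of size `s` touches at most `3s + 1` workspace variables.
[cite: ChatterjeeTengse2023, Def. 2.1 and Lemma 3.5 (v1: Def. 9, Lemma 42)] -/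
theorem card_touchedWork_le {Q : ProjCircuit k (ι ⊕ Fin w)} (h2 : Q.IsFanInTwo) :
    Q.touchedWork.card ≤ 3 * Q.size + 1 := by
  rw [touchedWork]
  refine Finset.card_toRight_le.trans ((Finset.card_union_le _ _).trans ?_)
  have := Q.card_varSet_le h2
  have := Q.card_projFinset_le
  omega

variable (Q : ProjCircuit k (ι ⊕ Fin w)) {W : ℕ} (hW : Q.touchedWork.card + 1 ≤ W)

/-- The compression of the variables: inputs fixed, the `l`-th touched workspace variable to
slot `l + 1`, untouched workspace variables to the junk slot `0` (they never occur).
[cite: ChatterjeeTengse2023, Lemma 3.5 (v1: Lemma 42)] -/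
def compressVar : ι ⊕ Fin w → ι ⊕ Fin W
  | .inl i => .inl i
  | .inr j => if h : j ∈ Q.touchedWork then
      .inr (Fin.castLE hW (Q.touchedWork.equivFin ⟨j, h⟩).succ) else .inr ⟨0, by omega⟩

/-- The operands of the compression: variables for touched variables, the constant `0` for the
untouched workspace. [cite: ChatterjeeTengse2023, Lemma 3.5 (v1: Lemma 42)] -/
def compressOp : ι ⊕ Fin w → ArithCircuit.Operand k (ι ⊕ Fin W)
  | .inl i => .var (.inl i)
  | .inr j => if j ∈ Q.touchedWork then .var (Q.compressVar hW (.inr j)) else .const 0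

/-- The substitution realised by the compression. [cite: ChatterjeeTengse2023, Lemma 3.5 (v1: Lemma 42)] -/
def compressSub : ι ⊕ Fin w → MvPolynomial (ι ⊕ Fin W) k
  | .inl i => X (.inl i)
  | .inr j => if j ∈ Q.touchedWork then X (Q.compressVar hW (.inr j)) else 0

/-- **Workspace compression** (brick E-a's `subst`, empty prefix).
[cite: ChatterjeeTengse2023, Lemma 3.5 (v1: Lemma 42)] -/
def compress : ProjCircuit k (ι ⊕ Fin W) :=
  Q.subst [] (Q.compressVar hW) (Q.compressOp hW)

omit [CommRing k] in
/-- The compression map is injective on inputs and touched workspace variables.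
[cite: ChatterjeeTengse2023, Lemma 3.5 (v1: Lemma 42)] -/
theorem compressVar_inr_of_mem {j : Fin w} (hj : j ∈ Q.touchedWork) :
    Q.compressVar hW (.inr j) = .inr (Fin.castLE hW (Q.touchedWork.equivFin ⟨j, hj⟩).succ) := by
  simp [compressVar, hj]

omit [CommRing k] in
/-- Distinct touched workspace variables stay distinct. [cite: ChatterjeeTengse2023, Lemma 3.5 (v1: Lemma 42)] -/
theorem compressVar_inr_ne {j j' : Fin w} (hj : j ∈ Q.touchedWork) (hj' : j' ∈ Q.touchedWork)
    (hne : j ≠ j') : Q.compressVar hW (.inr j) ≠ Q.compressVar hW (.inr j') := by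
  rw [Q.compressVar_inr_of_mem hW hj, Q.compressVar_inr_of_mem hW hj']
  intro h
  have h1 := Fin.castLE_injective hW (Sum.inr_injective h)
  have h2 := Fin.succ_injective _ h1
  have h3 := Q.touchedWork.equivFin.injective h2
  exact hne (congrArg Subtype.val h3)

omit [CommRing k] in
/-- A projected workspace variable is touched. [cite: ChatterjeeTengse2023, Lemma 3.5 (v1: Lemma 42)] -/
theorem mem_touchedWork_of_projVars {j : Fin w} (hj : (Sum.inr j : ι ⊕ Fin w) ∈ Q.projVars) :
    j ∈ Q.touchedWork := by
  rw [touchedWork, Finset.mem_toRight]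
  exact Finset.mem_union_right _ (mem_projFinset_iff.2 hj)

omit [CommRing k] in
/-- A read workspace variable is touched. [cite: ChatterjeeTengse2023, Lemma 3.5 (v1: Lemma 42)] -/
theorem mem_touchedWork_of_varSet {j : Fin w} (hj : (Sum.inr j : ι ⊕ Fin w) ∈ Q.varSet) :
    j ∈ Q.touchedWork := by
  rw [touchedWork, Finset.mem_toRight]
  exact Finset.mem_union_left _ hj

/-- **The compressed circuit computes the same input polynomial.**
[cite: ChatterjeeTengse2023, Lemma 3.5 (v1: Lemma 42)] -/
theorem eval_compress (U : MvPolynomial ι k) (hU : Q.Computes (rename Sum.inl U)) :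
    (Q.compress hW).eval = rename Sum.inl U := by
  have hρ : ∀ i ws, (Q.compressOp hW i).eval (gateValues ([] : List (Gate k (ι ⊕ Fin W))) ++ ws) =
      Q.compressSub hW i := by
    intro i ws
    cases i with
    | inl i => rfl
    | inr j =>
      by_cases hj : j ∈ Q.touchedWork
      · simp [compressOp, compressSub, hj, ArithCircuit.Operand.eval]
      · simp [compressOp, compressSub, hj, ArithCircuit.Operand.eval]
  have hX : ∀ (v v' : ι ⊕ Fin W), v' ∈ (X v : MvPolynomial (ι ⊕ Fin W) k).vars → v' = v := by
    intro v v' hv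
    classical
    rw [MvPolynomial.vars_def, Multiset.mem_toFinset] at hv
    exact Multiset.mem_singleton.1 (Multiset.mem_of_le (degrees_X' v) hv)
  have hcompat : Q.SubstCompat (Q.compressVar hW) (Q.compressSub hW) := by
    refine substCompat_of_vars Q (fun i hi => ?_) (fun i hi i' hi' hmem => ?_)
    · cases i with
      | inl i => rfl
      | inr j => simp [compressSub, Q.mem_touchedWork_of_projVars hi]
    · cases i' with
      | inl i₀ =>
        have h := hX _ _ hmem
        cases i with
        | inl i => exact hi' (by simpa [compressVar] using h.symm)
        | inr j => simp [Q.compressVar_inr_of_mem hW (Q.mem_touchedWork_of_projVars hi)] at h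
      | inr j' =>
        by_cases hj' : j' ∈ Q.touchedWork
        · simp only [compressSub, hj', if_true] at hmem
          have h := hX _ _ hmem
          cases i with
          | inl i =>
            rw [Q.compressVar_inr_of_mem hW hj'] at h
            simp [compressVar] at h
          | inr j =>
            by_cases hjj : j = j'
            · exact hi' (by rw [hjj])
            · exact Q.compressVar_inr_ne hW (Q.mem_touchedWork_of_projVars hi) hj' hjj h
        · simp [compressSub, hj'] at hmem
  rw [compress, eval_subst Q [] hρ hcompat, show Q.eval = rename Sum.inl U from hU,
    MvPolynomial.aeval_rename]
  refine DFunLike.congr_fun (MvPolynomial.algHom_ext fun i => ?_) U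
  simp [Function.comp_def, compressSub]

/-- Compression keeps the size. [cite: ChatterjeeTengse2023, Lemma 3.5 (v1: Lemma 42)] -/
theorem size_compress : (Q.compress hW).size = Q.size := Q.size_subst_nil _ _

/-- Compression keeps fan-in two. [cite: ChatterjeeTengse2023, Lemma 3.5 (v1: Lemma 42)] -/
theorem isFanInTwo_compress (h2 : Q.IsFanInTwo) : (Q.compress hW).IsFanInTwo :=
  isFanInTwo_subst h2 (by simp) _ _

/-- Compression keeps sign constants (the new operands are variables or the constant `0`).
[cite: ChatterjeeTengse2023, Lemma 3.5 (v1: Lemma 42)] -/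
theorem hasSignConstants_compress (h : Q.HasSignConstants) : (Q.compress hW).HasSignConstants := by
  refine hasSignConstants_subst h (by simp) _ (fun i => ?_)
  cases i with
  | inl i => exact ArithCircuit.Operand.hasSignConstants_var _
  | inr j =>
    by_cases hj : j ∈ Q.touchedWork
    · simp only [compressOp, hj, if_true]; exact ArithCircuit.Operand.hasSignConstants_var _
    · simp only [compressOp, hj, if_false]; exact ArithCircuit.isSignConstant_zero

/-- Compression keeps workspace-only projections. [cite: ChatterjeeTengse2023, Lemma 3.5 (v1: Lemma 42)] -/
theorem projVars_compress_subset (hQ : Q.projVars ⊆ Set.range Sum.inr) :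
    (Q.compress hW).projVars ⊆ Set.range Sum.inr := by
  intro v hv
  obtain ⟨u, hu, rfl⟩ := Q.projVars_subst_nil_subset _ _ hv
  obtain ⟨j, rfl⟩ := hQ hu
  by_cases hj : j ∈ Q.touchedWork
  · exact ⟨_, (Q.compressVar_inr_of_mem hW hj).symm⟩
  · exact ⟨⟨0, by omega⟩, by simp [compressVar, hj]⟩

/-- Compression sends projected variables to projected-variable images (general form).
[cite: ChatterjeeTengse2023, Lemma 3.5 (v1: Lemma 42)] -/
theorem projVars_compress_subset_image :
    (Q.compress hW).projVars ⊆ Q.compressVar hW '' Q.projVars :=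
  Q.projVars_subst_nil_subset _ _

end FrontEnd

/-! #### Specialising the index variables `y` to constants (Def. 1.7's assignments) -/

section Specialise

variable {α : Type v} {β : Type v} [DecidableEq α] [DecidableEq β] {W : ℕ}
variable (Q : ProjCircuit k ((α ⊕ β) ⊕ Fin W)) (a : β → k) (hW : 0 < W)

/-- The relabelling of the specialisation: inputs `α` and workspace kept, the (never projected)
index variables `β` sent to a workspace slot. [cite: ChatterjeeTengse2023, Def. 1.7 and Lemma 3.5 (v1: Def. 5, Lemma 42)] -/
def specVar : (α ⊕ β) ⊕ Fin W → α ⊕ Fin W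
  | .inl (.inl i) => .inl i
  | .inl (.inr _) => .inr ⟨0, hW⟩
  | .inr u => .inr u

/-- The operands of the specialisation: `y_j ↦ const (a j)`.
[cite: ChatterjeeTengse2023, Def. 1.7 and Lemma 3.5 (v1: Def. 5, Lemma 42)] -/
def specOp : (α ⊕ β) ⊕ Fin W → ArithCircuit.Operand k (α ⊕ Fin W)
  | .inl (.inl i) => .var (.inl i)
  | .inl (.inr j) => .const (a j)
  | .inr u => .var (.inr u)

/-- The substitution realised by the specialisation. [cite: ChatterjeeTengse2023, Def. 1.7 (v1: Def. 5)] -/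
def specSub : (α ⊕ β) ⊕ Fin W → MvPolynomial (α ⊕ Fin W) k
  | .inl (.inl i) => X (.inl i)
  | .inl (.inr j) => C (a j)
  | .inr u => X (.inr u)

/-- **Specialisation `y := a`** (brick E-a's `subst`, empty prefix, constant operands).
[cite: ChatterjeeTengse2023, Def. 1.7 and Lemma 3.5 "`C_G(·, a_t)`" (v1: Def. 5, Lemma 42)] -/
def specialise : ProjCircuit k (α ⊕ Fin W) :=
  Q.subst [] (specVar hW) (specOp a)

/-- **An INPUT-FREE circuit computing `U(z, y)` specialises to one computing `U(z, a)`** — sound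
exactly because no projection gate binds an input (registry B43).
[cite: ChatterjeeTengse2023, Def. 1.7 and Lemma 3.5 (v1: Def. 5, Lemma 42)] -/
theorem eval_specialise (hQ : Q.projVars ⊆ Set.range Sum.inr) (U : MvPolynomial (α ⊕ β) k)
    (hU : Q.Computes (rename Sum.inl U)) :
    (Q.specialise a hW).eval =
      rename Sum.inl (aeval (Sum.elim X fun j => C (a j)) U : MvPolynomial α k) := by
  have hρ : ∀ i ws, (specOp a i : ArithCircuit.Operand k (α ⊕ Fin W)).eval
      (gateValues ([] : List (Gate k (α ⊕ Fin W))) ++ ws) = specSub a i := by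
    rintro ((i | j) | u) ws <;> rfl
  have hX : ∀ (v v' : α ⊕ Fin W), v' ∈ (X v : MvPolynomial (α ⊕ Fin W) k).vars → v' = v := by
    intro v v' hv
    classical
    rw [MvPolynomial.vars_def, Multiset.mem_toFinset] at hv
    exact Multiset.mem_singleton.1 (Multiset.mem_of_le (degrees_X' v) hv)
  have hcompat : Q.SubstCompat (specVar hW) (specSub (W := W) a) := by
    refine substCompat_of_vars Q (fun i hi => ?_) (fun i hi i' hi' hmem => ?_)
    · obtain ⟨u, rfl⟩ := hQ hi
      rfl
    · obtain ⟨u, rfl⟩ := hQ hi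
      rcases i' with ((i₀ | j) | u')
      · exact absurd (hX _ _ hmem) (by simp [specVar])
      · simp [specSub, MvPolynomial.vars_C] at hmem
      · have h := hX _ _ hmem
        simp only [specVar, Sum.inr.injEq] at h
        exact hi' (by rw [h])
  rw [specialise, eval_subst Q [] hρ hcompat, show Q.eval = rename Sum.inl U from hU,
    MvPolynomial.aeval_rename, ← AlgHom.comp_apply, MvPolynomial.comp_aeval]
  refine DFunLike.congr_fun (MvPolynomial.algHom_ext fun i => ?_) U
  rcases i with (i | j) <;> simp [Function.comp_def, specSub]

omit [CommRing k] [DecidableEq α] [DecidableEq β] in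
/-- Specialisation keeps the size. [cite: ChatterjeeTengse2023, Lemma 3.5 (v1: Lemma 42)] -/
theorem size_specialise : (Q.specialise a hW).size = Q.size := Q.size_subst_nil _ _

omit [CommRing k] [DecidableEq α] [DecidableEq β] in
/-- Specialisation keeps fan-in two. [cite: ChatterjeeTengse2023, Lemma 3.5 (v1: Lemma 42)] -/
theorem isFanInTwo_specialise (h2 : Q.IsFanInTwo) : (Q.specialise a hW).IsFanInTwo :=
  isFanInTwo_subst h2 (by simp) _ _

omit [CommRing k] [DecidableEq α] [DecidableEq β] in
/-- Specialisation keeps workspace-only projections. [cite: ChatterjeeTengse2023, Lemma 3.5 (v1: Lemma 42)] -/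
theorem projVars_specialise_subset (hQ : Q.projVars ⊆ Set.range Sum.inr) :
    (Q.specialise a hW).projVars ⊆ Set.range Sum.inr := by
  intro v hv
  obtain ⟨u, hu, rfl⟩ := Q.projVars_subst_nil_subset _ _ hv
  obtain ⟨j, rfl⟩ := hQ hu
  exact ⟨j, rfl⟩

end Specialise

/-! #### From the hypotheses of `CT23_thm_3_1` to pre-specialised input-free encoders -/

section Thm31FrontEnd

variable {m r w n' : ℕ}

/-- **Front end of the assembly of Thm. 3.1.** From an ARBITRARY fan-in-two circuit with
projections `Q` (inputs `z ∈ Fin m`, index variables `y ∈ Fin r`, workspace `Fin w`) of size `s`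
computing `U(z, y)`, and assignments `a_t` with `U(z, a_t) = G_t(z)` (Def. 1.7), obtain `n'`
circuits over a COMMON small workspace `Fin t`, `t ≤ 9s + 4` (independent of `r` and `w`), each
of size `≤ 17s + 5`, fan-in two, computing `G_t(z)` and projecting WORKSPACE variables only — the
"pre-specialised copies `C_G(·, a_t)`" the encoder of Lemma 3.5 consumes, for every encoder the
typed fact admits (compression of the untouched workspace; input normalisation; specialisation).
[cite: ChatterjeeTengse2023, Thm. 3.1 via Def. 1.7 and Lemma 3.5 (v1: Def. 5, Lemma 42, p0015.txt:L80–L102)] -/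
theorem exists_specialised_inputFree (U : MvPolynomial (Fin m ⊕ Fin r) k)
    (G : Fin n' → MvPolynomial (Fin m) k) (Q : ProjCircuit k ((Fin m ⊕ Fin r) ⊕ Fin w))
    (h2 : Q.IsFanInTwo) (hU : Q.Computes (rename Sum.inl U)) (hG : Encodes U G) :
    ∃ (t : ℕ) (Qs : Fin n' → ProjCircuit k (Fin m ⊕ Fin t)), t ≤ 9 * Q.size + 4 ∧
      ∀ i, (Qs i).IsFanInTwo ∧ (Qs i).Computes (rename Sum.inl (G i)) ∧
        (Qs i).size ≤ 17 * Q.size + 5 ∧ (Qs i).projVars ⊆ Set.range Sum.inr := by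
  classical
  -- (1) compress the workspace to `Fin (3s + 2)`
  have hW : Q.touchedWork.card + 1 ≤ 3 * Q.size + 2 := by
    have := card_touchedWork_le h2; omega
  set Q₁ : ProjCircuit k ((Fin m ⊕ Fin r) ⊕ Fin (3 * Q.size + 2)) := Q.compress hW with hQ₁
  have h2₁ : Q₁.IsFanInTwo := Q.isFanInTwo_compress hW h2
  have hU₁ : Q₁.Computes (rename Sum.inl U) := Q.eval_compress hW U hU
  have hs₁ : Q₁.size = Q.size := Q.size_compress hW
  -- (2) input normalisation
  set Q₂ := Q₁.inputFree with hQ₂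
  have h2₂ : Q₂.IsFanInTwo := isFanInTwo_inputFree h2₁
  have hU₂ : Q₂.Computes (rename Sum.inl U) := by
    rw [Computes, hQ₂, eval_inputFree, show Q₁.eval = rename Sum.inl U from hU₁,
      rename_embed_rename_inl]
  have hs₂ : Q₂.size ≤ 17 * Q.size + 5 := by
    have := size_inputFree_le h2₁; rw [hs₁] at this; exact this
  have hp₂ : Q₂.projVars ⊆ Set.range Sum.inr := Q₁.projVars_inputFree_subset
  have hM : Q₁.inputCount ≤ 3 * Q.size + 1 := by
    have := inputCount_le h2₁; rw [hs₁] at this; exact this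
  have hWpos : 0 < 3 * Q.size + 2 + 2 * Q₁.inputCount := by omega
  -- (3) specialise `y := a_i`
  refine ⟨3 * Q.size + 2 + 2 * Q₁.inputCount,
    fun i => Q₂.specialise (Classical.choose (hG i)) hWpos, by omega, fun i => ⟨?_, ?_, ?_, ?_⟩⟩
  · exact Q₂.isFanInTwo_specialise _ hWpos h2₂
  · rw [Computes, Q₂.eval_specialise _ hWpos hp₂ U hU₂, Classical.choose_spec (hG i)]
  · rw [Q₂.size_specialise]; exact hs₂
  · exact Q₂.projVars_specialise_subset _ hWpos hp₂

/-- The size arithmetic of the assembly: `(m·d·(17s+5))^c ≤ (m·d·s)^(6c)` for `s ≥ 2`.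
[cite: ChatterjeeTengse2023, Thm. 3.1 "(m·d·s)^c" (v1: §3.3, p0016.txt:L12–L24)] -/
theorem mul_frontEnd_pow_le {m d s c : ℕ} (hm : 1 ≤ m) (hd : 1 ≤ d) (hs : 2 ≤ s) :
    (m * d * (17 * s + 5)) ^ c ≤ (m * d * s) ^ (6 * c) := by
  rw [pow_mul]
  apply Nat.pow_le_pow_left
  have h5 : 2 ^ 5 ≤ s ^ 5 := Nat.pow_le_pow_left hs 5
  have h1 : 17 * s + 5 ≤ s ^ 6 :=
    calc 17 * s + 5 ≤ 2 ^ 5 * s := by omega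
      _ ≤ s ^ 5 * s := Nat.mul_le_mul_right _ h5
      _ = s ^ 6 := by ring
  have hmd : 1 ≤ m * d := Nat.one_le_iff_ne_zero.2 (Nat.mul_ne_zero (by omega) (by omega))
  calc m * d * (17 * s + 5) ≤ m * d * s ^ 6 := Nat.mul_le_mul_left _ h1
    _ ≤ (m * d) ^ 6 * s ^ 6 := by
        refine Nat.mul_le_mul_right _ ?_
        calc m * d = (m * d) ^ 1 := (pow_one _).symm
          _ ≤ (m * d) ^ 6 := Nat.pow_le_pow_right hmd (by norm_num)
    _ = (m * d * s) ^ 6 := by ring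

end Thm31FrontEnd

end ProjCircuit

end Literature.Barriers.ValiantsHypothesis
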